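import Summits.AtomisticToContinuum.FouriersLaw.Theorems.PhononMeanFreePathIncoherentChannelTwoHorizonsMean
import Summits.AtomisticToContinuum.FouriersLaw.Theorems.PhononMeanFreePathIncoherentChannelVarianceTransportHelper1
import Summits.AtomisticToContinuum.FouriersLaw.Theorems.IncoherentChannel.Negative.HarmonicWick

/-!
# `IncoherentChannel` (stmt-AtomisticToContinuum-11811) from the forecast-loss envelope and the variance-channel limit

Line `two-horizons-forecast-loss`, lead prover-line-stmt-AtomisticToContinuum-11811-0: the line's composition
`IncoherentChannel_of` with the two LANDED stubs discharged (`stub_lightCone` p92940, `stub_commonPastBound` p89690,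
inside `twoHorizons_meanChannels`) and the fixed-`N` integrability half of the variance channel landed
(`varianceTransport_integrableOn`, p87312). What remains are exactly TWO hypotheses, stated verbatim (registered stubs of
the crux; NOT published facts):

* `h₁` — the N-uniform forecast-loss envelope (`stub_forecastLoss`): `S_N(t) ≤ C(1+t)^{−α}`, `α > 2`;
* `h₄` — the variance-channel limit (`stub_varianceLimit`, the reshaped transport core):
  `∃ κ > 0, N(γ²/T²)∫₀^∞ B_N → κ`, `B_N = varianceChannel = Cov_{μ₀}(p_0², Var(p_N(t) | z_0))`.

* `twoHorizons_cruxSeq_tendsto_of_split` — channel split `C_N − 2r_N² = B_N + (P_N − 2r_N²)` (`ring` after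
  unfolding) + `integral_add`: if `N(γ²/T²)∫B_N → κ` and `N∫(P_N − 2r_N²) → 0` then the crux's own sequence —
  written VERBATIM as in the route decl — tends to `κ`.
* `incoherentChannel_of_forecastLoss_of_varianceLimit h₁ h₄ : IncoherentChannel` — the crux BY NAME from the two
  remaining statements.
* `twoHorizons_commonPast_channel`, `powerCovLimit_iff_varianceLimit_of_forecastLoss`,
  `incoherentChannel_of_forecastLoss_of_powerCovLimit` — given the envelope, `N∫P_N → 0`, so the variance form and the
  KUBO form `N(γ²/T²)∫₀^∞ C_N → κ` of the transport core have the same limit, and the crux follows from the envelope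
  plus the Kubo-form Fourier law (`C_N = powerCov` = the kernel of `BoundaryKubo`, whose `D_{N+1}`-identification
  makes it `D_{N+1} → κ`).
* Harmonic-corner calibration against the landed Negative lemmas (`HarmonicWick.harmonic_wick`,
  `not_crux_at_harmonic`): at `lam = β = 0` the two integrands sum to the vanishing cumulant kernel, and the harmonic
  analogues of `h₄` and of the mean-channel limit cannot both hold — where the line uses `0 < lam ∧ 0 < β`.

No definition, no `sorry`, axioms standard.
-/

noncomputable section

open MeasureTheory Set Filter Topology
open scoped NNReal

namespace Summit.AtomisticToContinuum.FouriersLaw.Theorems.PhononMeanFreePath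

open Literature.MathematicalPhysics.KineticTheory.HeatConduction
open Summit.AtomisticToContinuum.FouriersLaw.Theses.PhononMeanFreePath (IncoherentChannel)

/-- CHANNEL SPLIT (pure algebra + `integral_add`): pointwise `C_N − 2r_N² = B_N + (P_N − 2r_N²)` by definitional
unfolding and `ring`; hence if `N(γ²/T²)∫B_N → κ` and `N∫(P_N − 2r_N²) → 0` (both integrands integrable at each
`N`), the crux's own sequence — written VERBATIM as in the route decl — tends to `κ`. Stated for all real
parameters (used at `lam, β > 0` by `IncoherentChannel_of` and at the harmonic corner by the calibration). [folklore] -/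
theorem twoHorizons_cruxSeq_tendsto_of_split {ω₂ lam β γ T κ : ℝ}
    (hBint : ∀ N : ℕ, IntegrableOn (varianceChannel ω₂ lam β γ T N) (Ioi (0 : ℝ)))
    (hBlim : Tendsto (fun N : ℕ => (N : ℝ) * (γ ^ 2 / T ^ 2) *
      ∫ t in Ioi (0 : ℝ), varianceChannel ω₂ lam β γ T N t) atTop (𝓝 κ))
    (hMint : ∀ N : ℕ, IntegrableOn
      (fun t => commonPast ω₂ lam β γ T N t - 2 * (pairCorr ω₂ lam β γ T N t) ^ 2) (Ioi (0 : ℝ)))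
    (hMlim : Tendsto (fun N : ℕ => (N : ℝ) * ∫ t in Ioi (0 : ℝ),
      (commonPast ω₂ lam β γ T N t - 2 * (pairCorr ω₂ lam β γ T N t) ^ 2)) atTop (𝓝 0)) :
    Filter.Tendsto (fun N : ℕ => (N : ℝ) * (γ ^ 2 / T ^ 2) * ∫ t in Set.Ioi (0 : ℝ),
      ((∫ z, (z.2 0) ^ 2 * (∫ y, (y.2 (Fin.last N)) ^ 2 ∂((pinnedChain ω₂ lam β γ).transitionKernel (N + 1) T T t.toNNReal z)) ∂((pinnedChain ω₂ lam β γ).gibbsMeasure (N + 1) T)) -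
        (∫ z, (z.2 0) ^ 2 ∂((pinnedChain ω₂ lam β γ).gibbsMeasure (N + 1) T)) *
          (∫ z, (∫ y, (y.2 (Fin.last N)) ^ 2 ∂((pinnedChain ω₂ lam β γ).transitionKernel (N + 1) T T t.toNNReal z)) ∂((pinnedChain ω₂ lam β γ).gibbsMeasure (N + 1) T)) -
        2 * (∫ z, z.2 0 * (∫ y, y.2 (Fin.last N) ∂((pinnedChain ω₂ lam β γ).transitionKernel (N + 1) T T t.toNNReal z)) ∂((pinnedChain ω₂ lam β γ).gibbsMeasure (N + 1) T)) ^ 2))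
      Filter.atTop (nhds κ) := by
  have key : ∀ N : ℕ,
      (N : ℝ) * (γ ^ 2 / T ^ 2) * ∫ t in Set.Ioi (0:ℝ),
        ((∫ z, (z.2 0) ^ 2 * (∫ y, (y.2 (Fin.last N)) ^ 2 ∂((pinnedChain ω₂ lam β γ).transitionKernel (N + 1) T T t.toNNReal z)) ∂((pinnedChain ω₂ lam β γ).gibbsMeasure (N + 1) T)) -
          (∫ z, (z.2 0) ^ 2 ∂((pinnedChain ω₂ lam β γ).gibbsMeasure (N + 1) T)) *
            (∫ z, (∫ y, (y.2 (Fin.last N)) ^ 2 ∂((pinnedChain ω₂ lam β γ).transitionKernel (N + 1) T T t.toNNReal z)) ∂((pinnedChain ω₂ lam β γ).gibbsMeasure (N + 1) T)) -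
          2 * (∫ z, z.2 0 * (∫ y, y.2 (Fin.last N) ∂((pinnedChain ω₂ lam β γ).transitionKernel (N + 1) T T t.toNNReal z)) ∂((pinnedChain ω₂ lam β γ).gibbsMeasure (N + 1) T)) ^ 2)
      = (N : ℝ) * (γ ^ 2 / T ^ 2) * (∫ t in Set.Ioi (0:ℝ), varianceChannel ω₂ lam β γ T N t) +
        (γ ^ 2 / T ^ 2) * ((N : ℝ) * ∫ t in Set.Ioi (0:ℝ),
          (commonPast ω₂ lam β γ T N t - 2 * (pairCorr ω₂ lam β γ T N t) ^ 2)) := by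
    intro N
    rw [show (γ ^ 2 / T ^ 2) * ((N : ℝ) * ∫ t in Set.Ioi (0:ℝ),
          (commonPast ω₂ lam β γ T N t - 2 * (pairCorr ω₂ lam β γ T N t) ^ 2)) =
        (N : ℝ) * (γ ^ 2 / T ^ 2) * ∫ t in Set.Ioi (0:ℝ),
          (commonPast ω₂ lam β γ T N t - 2 * (pairCorr ω₂ lam β γ T N t) ^ 2) by ring,
      ← mul_add, ← integral_add (hBint N) (hMint N)]
    congr 1
    refine setIntegral_congr_fun measurableSet_Ioi (fun t _ => ?_)
    simp only [varianceChannel, powerCov, commonPast, pairCorr, fcast]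
    ring
  simp_rw [key]
  simpa using hBlim.add (hMlim.const_mul (γ ^ 2 / T ^ 2))

/-- **`IncoherentChannel` (crux stmt-AtomisticToContinuum-11811) BY NAME from the two remaining statements of the
line**: the forecast-loss envelope `h₁` (registered stub `stub_forecastLoss`) and the variance-channel limit `h₄`
(registered stub `stub_varianceLimit`); causality, the fixed-`N` dictionary and the fixed-`N` integrability of `B_N`
are landed theorems. CONDITIONAL on `h₁ ∧ h₄` (neither is a published fact; `h₄` is transport-strength). [folklore] -/
theorem incoherentChannel_of_forecastLoss_of_varianceLimit : (∀ ω₂ lam β γ : ℝ, 0 < ω₂ → 0 < lam → 0 < β → 0 < γ → ∀ T : ℝ, 0 < T → ∃ C α : ℝ, 2 < α ∧ ∀ (N : ℕ) (t : ℝ), 0 ≤ t → fnorm ω₂ lam β γ T N t ≤ C * (1 + t) ^ (-α)) → (∀ ω₂ lam β γ : ℝ, 0 < ω₂ → 0 < lam → 0 < β → 0 < γ → ∀ T : ℝ, 0 < T → ∃ κ : ℝ, 0 < κ ∧ Tendsto (fun N : ℕ => (N : ℝ) * (γ ^ 2 / T ^ 2) * ∫ t in Ioi (0 : ℝ), varianceChannel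 ω₂ lam β γ T N t) atTop (𝓝 κ)) → Summit.AtomisticToContinuum.FouriersLaw.Theses.PhononMeanFreePath.IncoherentChannel := by
  intro h₁ h₄ ω₂ lam β γ hω hl hβ hγ T hT
  obtain ⟨κ, hκ, hBlim⟩ := h₄ ω₂ lam β γ hω hl hβ hγ T hT
  have hBint := varianceTransport_integrableOn ω₂ lam β γ hω hl hβ hγ T hT
  obtain ⟨hMint, hMlim, -, -⟩ := twoHorizons_meanChannels h₁ hω hl hβ hγ hT
  exact ⟨κ, hκ, twoHorizons_cruxSeq_tendsto_of_split hBint hBlim hMint hMlim⟩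

/-! ## The Kubo form: given the envelope, the crux is the limit of `N(γ²/T²)∫₀^∞ C_N` -/

/-- **Given the forecast-loss envelope, the common-past part is `o(1/N)` after time integration**:
`P_N ∈ L¹(0,∞)` for every `N` (landed, fixed `N`) and `N·∫₀^∞ P_N → 0` (from `twoHorizons_meanChannels`:
`N∫(P_N − 2r_N²) → 0` and `N∫r_N² → 0`). [folklore] -/
theorem twoHorizons_commonPast_channel
    (h₁ : ∀ ω₂ lam β γ : ℝ, 0 < ω₂ → 0 < lam → 0 < β → 0 < γ → ∀ T : ℝ, 0 < T →
      ∃ C α : ℝ, 2 < α ∧ ∀ (N : ℕ) (t : ℝ), 0 ≤ t → fnorm ω₂ lam β γ T N t ≤ C * (1 + t) ^ (-α))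
    {ω₂ lam β γ : ℝ} (hω : 0 < ω₂) (hl : 0 < lam) (hβ : 0 < β) (hγ : 0 < γ) {T : ℝ} (hT : 0 < T) :
    (∀ N : ℕ, IntegrableOn (commonPast ω₂ lam β γ T N) (Ioi (0 : ℝ))) ∧
    Tendsto (fun N : ℕ => (N : ℝ) * ∫ t in Ioi (0 : ℝ), commonPast ω₂ lam β γ T N t) atTop (𝓝 0) := by
  obtain ⟨hMint, hMlim, hrint, hrlim⟩ := twoHorizons_meanChannels h₁ hω hl hβ hγ hT
  have hPint : ∀ N : ℕ, IntegrableOn (commonPast ω₂ lam β γ T N) (Ioi (0 : ℝ)) :=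
    commonPast_integrableOn ω₂ lam β γ hω hl hβ hγ T hT
  refine ⟨hPint, ?_⟩
  have key : ∀ N : ℕ, (N : ℝ) * ∫ t in Ioi (0 : ℝ), commonPast ω₂ lam β γ T N t =
      (N : ℝ) * (∫ t in Ioi (0 : ℝ), (commonPast ω₂ lam β γ T N t - 2 * (pairCorr ω₂ lam β γ T N t) ^ 2)) +
        2 * ((N : ℝ) * ∫ t in Ioi (0 : ℝ), (pairCorr ω₂ lam β γ T N t) ^ 2) := by
    intro N
    have e : ∫ t in Ioi (0 : ℝ), commonPast ω₂ lam β γ T N t =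
        (∫ t in Ioi (0 : ℝ), (commonPast ω₂ lam β γ T N t - 2 * (pairCorr ω₂ lam β γ T N t) ^ 2)) +
          ∫ t in Ioi (0 : ℝ), 2 * (pairCorr ω₂ lam β γ T N t) ^ 2 := by
      rw [← integral_add (hMint N) ((hrint N).const_mul 2)]
      refine setIntegral_congr_fun measurableSet_Ioi (fun t _ => ?_)
      ring
    rw [e, integral_const_mul]
    ring
  simp_rw [key]
  simpa using hMlim.add (hrlim.const_mul 2)

/-- **Given the envelope, the Kubo form and the variance form of the transport core have the SAME limit**:
`N(γ²/T²)∫₀^∞ C_N → κ ↔ N(γ²/T²)∫₀^∞ B_N → κ` (`C_N = B_N + P_N`, `N∫P_N → 0`). So the reshaped stub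
`stub_varianceLimit` is, modulo the envelope, exactly the Kubo-form Fourier law (`= D_{N+1} → κ` under the sibling
`BoundaryKubo`). [folklore] -/
theorem powerCovLimit_iff_varianceLimit_of_forecastLoss
    (h₁ : ∀ ω₂ lam β γ : ℝ, 0 < ω₂ → 0 < lam → 0 < β → 0 < γ → ∀ T : ℝ, 0 < T →
      ∃ C α : ℝ, 2 < α ∧ ∀ (N : ℕ) (t : ℝ), 0 ≤ t → fnorm ω₂ lam β γ T N t ≤ C * (1 + t) ^ (-α))
    {ω₂ lam β γ : ℝ} (hω : 0 < ω₂) (hl : 0 < lam) (hβ : 0 < β) (hγ : 0 < γ) {T : ℝ} (hT : 0 < T) (κ : ℝ) :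
    Tendsto (fun N : ℕ => (N : ℝ) * (γ ^ 2 / T ^ 2) * ∫ t in Ioi (0 : ℝ), powerCov ω₂ lam β γ T N t)
        atTop (𝓝 κ) ↔
      Tendsto (fun N : ℕ => (N : ℝ) * (γ ^ 2 / T ^ 2) * ∫ t in Ioi (0 : ℝ), varianceChannel ω₂ lam β γ T N t)
        atTop (𝓝 κ) := by
  obtain ⟨hPint, hPlim⟩ := twoHorizons_commonPast_channel h₁ hω hl hβ hγ hT
  have hBint := varianceTransport_integrableOn ω₂ lam β γ hω hl hβ hγ T hT
  have key : ∀ N : ℕ, (N : ℝ) * (γ ^ 2 / T ^ 2) * ∫ t in Ioi (0 : ℝ), powerCov ω₂ lam β γ T N t =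
      (N : ℝ) * (γ ^ 2 / T ^ 2) * (∫ t in Ioi (0 : ℝ), varianceChannel ω₂ lam β γ T N t) +
        (γ ^ 2 / T ^ 2) * ((N : ℝ) * ∫ t in Ioi (0 : ℝ), commonPast ω₂ lam β γ T N t) := by
    intro N
    have e : ∫ t in Ioi (0 : ℝ), powerCov ω₂ lam β γ T N t =
        (∫ t in Ioi (0 : ℝ), varianceChannel ω₂ lam β γ T N t) + ∫ t in Ioi (0 : ℝ), commonPast ω₂ lam β γ T N t := by
      rw [← integral_add (hBint N) (hPint N)]
      refine setIntegral_congr_fun measurableSet_Ioi (fun t _ => ?_)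
      simp only [varianceChannel]
      ring
    rw [e]
    ring
  have h0 : Tendsto (fun N : ℕ => (γ ^ 2 / T ^ 2) * ((N : ℝ) * ∫ t in Ioi (0 : ℝ), commonPast ω₂ lam β γ T N t))
      atTop (𝓝 0) := by simpa using hPlim.const_mul (γ ^ 2 / T ^ 2)
  simp_rw [key]
  constructor
  · intro h
    have := h.sub h0
    simpa using this
  · intro h
    simpa using h.add h0

/-- **`IncoherentChannel` from the envelope and the KUBO-FORM Fourier law** `∃ κ > 0, N(γ²/T²)∫₀^∞ C_N → κ`
(`C_N = powerCov`, the crux's / `BoundaryKubo`'s kernel): the crux integrand is `C_N − 2r_N²` and `N∫r_N² → 0` is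
PROVED modulo the envelope. The shortest honest statement of what is left of the crux after this line: the fixed-`N`
Kubo identity (`BoundaryKubo`: `D_{N+1} = N(γ²/T²)∫C_N`) aside, it is the existence and positivity of `lim D_N`.
[folklore] -/
theorem incoherentChannel_of_forecastLoss_of_powerCovLimit : (∀ ω₂ lam β γ : ℝ, 0 < ω₂ → 0 < lam → 0 < β → 0 < γ → ∀ T : ℝ, 0 < T → ∃ C α : ℝ, 2 < α ∧ ∀ (N : ℕ) (t : ℝ), 0 ≤ t → fnorm ω₂ lam β γ T N t ≤ C * (1 + t) ^ (-α)) → (∀ ω₂ lam β γ : ℝ, 0 < ω₂ → 0 < lam → 0 < β → 0 < γ → ∀ T : ℝ, 0 < T → ∃ κ : ℝ, 0 < κ ∧ Tendsto (fun N : ℕ => (N : ℝ) * (γ ^ 2 / T ^ 2) * ∫ t in Ioi (0 : ℝ), powerCov ω₂ lam β γ T N t) atTop (𝓝 κ)) → Summit.AtomisticToContinuum.FouriersLaw.Theses.PhononMeanFreePath.IncoherentChannel := by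
  intro h₁ hK
  refine incoherentChannel_of_forecastLoss_of_varianceLimit h₁ (fun ω₂ lam β γ hω hl hβ hγ T hT => ?_)
  obtain ⟨κ, hκ, hlim⟩ := hK ω₂ lam β γ hω hl hβ hγ T hT
  exact ⟨κ, hκ, (powerCovLimit_iff_varianceLimit_of_forecastLoss h₁ hω hl hβ hγ hT κ).1 hlim⟩

/-! ## Calibration at the harmonic corner (landed Negative lemmas, imported) -/

/-- At `lam = β = 0` the two integrands of the composition sum to the cumulant kernel, which VANISHES IDENTICALLY by
the landed Negative lemma `HarmonicWick.harmonic_wick` (p77793): `B_N + (P_N − 2r_N²) = C_N − 2r_N² ≡ 0`. [folklore] -/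
theorem twoHorizons_harmonic_corner_integrands_sum_zero {ω₂ γ T : ℝ} (hω : 0 < ω₂) (hγ : 0 ≤ γ) (hT : 0 < T)
    (N : ℕ) (t : ℝ) :
    varianceChannel ω₂ 0 0 γ T N t + (commonPast ω₂ 0 0 γ T N t - 2 * (pairCorr ω₂ 0 0 γ T N t) ^ 2) = 0 := by
  have h := Summit.AtomisticToContinuum.FouriersLaw.Theorems.IncoherentChannel.Negative.HarmonicWick.harmonic_wick
    hω hγ hT N t
  have e : varianceChannel ω₂ 0 0 γ T N t + (commonPast ω₂ 0 0 γ T N t - 2 * (pairCorr ω₂ 0 0 γ T N t) ^ 2) =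
      powerCov ω₂ 0 0 γ T N t - 2 * (pairCorr ω₂ 0 0 γ T N t) ^ 2 := by
    simp only [varianceChannel]; ring
  rw [e, sub_eq_zero]
  exact h

/-- **Where the line uses `0 < lam ∧ 0 < β`** (honouring `LoadBearing.crux_false_without_anharmonicity_of_wick` /
`HarmonicWick.crux_false_without_anharmonicity`): at the harmonic corner the conclusions of STUB 4 (variance
transport with `κ > 0`) and of `meanChannels_of` (mean channel `o(1/N)`) CANNOT both hold — by the channel split
they would certify the harmonic crux, refuted by the landed lemma `HarmonicWick.not_crux_at_harmonic`. In the line,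
`stub_varianceTransport` is false there (`B_N ≡ 0`, Kalman) and so is `stub_forecastLoss` (forecast plateau), while
`stub_lightCone` and `stub_commonPastBound` hold at the corner. [folklore] -/
theorem twoHorizons_harmonic_corner_not_both {ω₂ γ T : ℝ} (hω : 0 < ω₂) (hγ : 0 < γ) (hT : 0 < T) :
    ¬ ((∃ κ : ℝ, 0 < κ ∧ (∀ N : ℕ, IntegrableOn (varianceChannel ω₂ 0 0 γ T N) (Ioi (0 : ℝ))) ∧
          Tendsto (fun N : ℕ => (N : ℝ) * (γ ^ 2 / T ^ 2) *
            ∫ t in Ioi (0 : ℝ), varianceChannel ω₂ 0 0 γ T N t) atTop (𝓝 κ)) ∧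
       ((∀ N : ℕ, IntegrableOn
            (fun t => commonPast ω₂ 0 0 γ T N t - 2 * (pairCorr ω₂ 0 0 γ T N t) ^ 2) (Ioi (0 : ℝ))) ∧
          Tendsto (fun N : ℕ => (N : ℝ) * ∫ t in Ioi (0 : ℝ),
            (commonPast ω₂ 0 0 γ T N t - 2 * (pairCorr ω₂ 0 0 γ T N t) ^ 2)) atTop (𝓝 0))) := by
  rintro ⟨⟨κ, hκ, hBint, hBlim⟩, hMint, hMlim⟩
  exact Summit.AtomisticToContinuum.FouriersLaw.Theorems.IncoherentChannel.Negative.HarmonicWick.not_crux_at_harmonic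
    hω hγ.le hT ⟨κ, hκ, twoHorizons_cruxSeq_tendsto_of_split hBint hBlim hMint hMlim⟩

end Summit.AtomisticToContinuum.FouriersLaw.Theorems.PhononMeanFreePath

end
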